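import Summits.AtomisticToContinuum.HydrodynamicLimit.Theorems.LambertianContactSwapLambertianEulerGaussianFrame
import Summits.AtomisticToContinuum.HydrodynamicLimit.Theorems.LambertianContactSwapLambertianEulerRadialArchimedes
import HarnessLib

/-!
# The Lambert (Knudsen cosine) law of the redrawn direction
# (`LambertianContactSwap.LambertianEuler`, stmt-AtomisticToContinuum-11854, line `Sketch`,
# stub `stub_lambertLaw`)

For a contact normal `ω ≠ 0` of `ℝ³` and a standard Gaussian vector `ξ`, the Lambertian
direction `n = lambertDir ω ξ = normalize(ω̂ + ξ̂)` of the route's cosine redraw has the law of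
the uniform point `ξ̂ = ξ/‖ξ‖` of the unit sphere weighted by `4 (ω̂ · ξ̂)₊`:
`∫ F(lambertDir ω ξ) dγ(ξ) = ∫ 4 (ω̂ · ξ̂)₊ F(ξ̂) dγ(ξ)` for every measurable `F ≥ 0`
(`lambertLaw`) — the cosine law `(n · ω̂)₊ dσ(n)/π` on the outgoing hemisphere
(Comets–Popov–Schütz–Vachkovskaia 2008 §2.1; Feres–Yablonsky 2004), which is at the same time the
flux-invariance identity of the cosine redraw (incoming contact flux ↦ outgoing contact flux, the
boundary identity of Liouville's theorem for the Lambertian gas). (Archimedes' theorem on `ℝ³`, the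
same cylindrical route, is landed separately: `…LambertianEulerArchimedes.archimedesV3`.)

Proof: cylindrical coordinates about `ω̂`
(`…GaussianFrame.lintegral_stdGaussian_framePolar`): for each azimuth both integrands are
functions of the polar cosine `t = c/√(c² + r²)` — `F(Ψ_θ(√((1+t)/2)))` on the left
(`lambertDir_frame`: the redraw halves the polar angle) and `4t₊ F(Ψ_θ(t))` on the right — whose
`(c, r)`-law is `dt/2` (`…RadialArchimedes.radialArchimedes`); the substitution `t = 2s² − 1`
(`setLIntegral_comp_halfAngle`) matches the two sides.
-/

noncomputable section

open MeasureTheory ProbabilityTheory Set Real Filter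
open scoped ENNReal InnerProductSpace

namespace Summit.AtomisticToContinuum.HydrodynamicLimit.Theorems.LambertianContactSwapLambertianEulerLambertLaw

open Literature.MathematicalPhysics.KineticTheory Literature.Analysis.FluidPDE
open Summit.AtomisticToContinuum.HydrodynamicLimit.Theorems.LambertianContactSwapLambertianEulerGaussianFrame
open Summit.AtomisticToContinuum.HydrodynamicLimit.Theorems.LambertianContactSwapLambertianEulerRadialArchimedes

/-- Left integrand in cylindrical coordinates: for unit `ω`, `r > 0` and any azimuth `θ`,
`r (2π)⁻¹ e^{-r²/2} F(lambertDir ω (c ω + r u_θ)) = (r e^{-r²/2}) · ((2π)⁻¹ F(Ψ_θ(√((1+t)/2))))`,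
`t = c/√(c² + r²)`, `Ψ_θ(s) = s ω + √(1 − s²) u_θ`. [folklore] -/
theorem integrand_left {ω : V3} (hω : ‖ω‖ = 1) (F : V3 → ℝ≥0∞) (c : ℝ) {r : ℝ} (hr : 0 < r)
    (θ : ℝ) :
    ENNReal.ofReal (r * ((2 * π)⁻¹ * rexp (-r ^ 2 / 2))) *
        F (lambertDir ω (c • ω + r • (Real.cos θ • Lambert.e₁ ω + Real.sin θ • Lambert.e₂ ω))) =
      ENNReal.ofReal (r * rexp (-r ^ 2 / 2)) * (ENNReal.ofReal ((2 * π)⁻¹) *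
        F (√((1 + c / √(c ^ 2 + r ^ 2)) / 2) • ω +
          √(1 - (√((1 + c / √(c ^ 2 + r ^ 2)) / 2)) ^ 2) •
            (Real.cos θ • Lambert.e₁ ω + Real.sin θ • Lambert.e₂ ω))) := by
  rw [lambertDir_frame hω (norm_azimuth hω θ) (inner_self_azimuth ω θ) c hr,
    ofReal_weight_mul _ (mul_nonneg hr.le (Real.exp_pos _).le)]

/-- Right integrand in cylindrical coordinates: for unit `ω`, `r > 0` and any azimuth `θ`, with
`ξ = c ω + r u_θ`, `r (2π)⁻¹ e^{-r²/2} · (4(⟪ω, ξ̂⟫)₊ F(ξ̂)) = (r e^{-r²/2}) · (4 t₊ · ((2π)⁻¹ F(Ψ_θ(t))))`.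
[folklore] -/
theorem integrand_right {ω : V3} (hω : ‖ω‖ = 1) (F : V3 → ℝ≥0∞) (c : ℝ) {r : ℝ} (hr : 0 < r)
    (θ : ℝ) :
    ENNReal.ofReal (r * ((2 * π)⁻¹ * rexp (-r ^ 2 / 2))) *
        (ENNReal.ofReal (4 * max (⟪ω, ‖c • ω + r • (Real.cos θ • Lambert.e₁ ω +
            Real.sin θ • Lambert.e₂ ω)‖⁻¹ • (c • ω + r • (Real.cos θ • Lambert.e₁ ω +
              Real.sin θ • Lambert.e₂ ω))⟫_ℝ) 0) *
          F (‖c • ω + r • (Real.cos θ • Lambert.e₁ ω + Real.sin θ • Lambert.e₂ ω)‖⁻¹ •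
            (c • ω + r • (Real.cos θ • Lambert.e₁ ω + Real.sin θ • Lambert.e₂ ω)))) =
      ENNReal.ofReal (r * rexp (-r ^ 2 / 2)) *
        (ENNReal.ofReal (4 * max (c / √(c ^ 2 + r ^ 2)) 0) * (ENNReal.ofReal ((2 * π)⁻¹) *
          F ((c / √(c ^ 2 + r ^ 2)) • ω + √(1 - (c / √(c ^ 2 + r ^ 2)) ^ 2) •
            (Real.cos θ • Lambert.e₁ ω + Real.sin θ • Lambert.e₂ ω)))) := by
  rw [inner_unitVec_eq hω (norm_azimuth hω θ) (inner_self_azimuth ω θ) c hr,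
    unitVec_eq hω (norm_azimuth hω θ) (inner_self_azimuth ω θ) c hr,
    ofReal_weight_mul _ (mul_nonneg hr.le (Real.exp_pos _).le)]
  ring

/-- Joint measurability of the azimuth-parametrised integrand
`(s, θ) ↦ (2π)⁻¹ F(s ω + √(1 − s²) u_θ)`. [folklore] -/
theorem measurable_meridian_integrand (ω : V3) {F : V3 → ℝ≥0∞} (hF : Measurable F) :
    Measurable fun p : ℝ × ℝ => ENNReal.ofReal ((2 * π)⁻¹) *
      F (p.1 • ω + √(1 - p.1 ^ 2) • (Real.cos p.2 • Lambert.e₁ ω + Real.sin p.2 • Lambert.e₂ ω)) :=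
  measurable_const.mul (hF.comp (continuous_meridian ω).measurable)

/-- **The Lambert law for a unit normal**, given radial Archimedes (hypothesis `hRA`: under
`γ₁(dc) ⊗ r e^{-r²/2} dr` the polar cosine `c/√(c²+r²)` is uniform on `[-1, 1]`):
`∫ F(lambertDir ω ξ) dγ(ξ) = ∫ 4(⟪ω, ξ̂⟫)₊ F(ξ̂) dγ(ξ)`. [cite: CometsEtAl2008, §2.1] -/
theorem lambertLaw_unit
    (hRA : ∀ G : ℝ → ℝ≥0∞, Measurable G →
      ∫⁻ x, (∫⁻ r in Set.Ioi (0 : ℝ), ENNReal.ofReal (r * Real.exp (-r ^ 2 / 2)) *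
          G (x / Real.sqrt (x ^ 2 + r ^ 2))) ∂(gaussianReal 0 1) =
        2⁻¹ * ∫⁻ t in Set.Icc (-1 : ℝ) 1, G t)
    {ω : V3} (hω : ‖ω‖ = 1) {F : V3 → ℝ≥0∞} (hF : Measurable F) :
    ∫⁻ ξ, F (lambertDir ω ξ) ∂(stdGaussian V3) =
      ∫⁻ ξ, ENNReal.ofReal (4 * max (⟪ω, ‖ξ‖⁻¹ • ξ⟫_ℝ) 0) * F (‖ξ‖⁻¹ • ξ) ∂(stdGaussian V3) := by
  have hfm := measurable_meridian_integrand ω hF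
  -- the azimuth-averaged observable `Gt s = ∫_θ (2π)⁻¹ F(Ψ_θ(s))` is measurable in `s`
  have hGtm : Measurable fun s : ℝ => ∫⁻ θ in Ioo (-π) π, ENNReal.ofReal ((2 * π)⁻¹) *
      F (s • ω + √(1 - s ^ 2) • (Real.cos θ • Lambert.e₁ ω + Real.sin θ • Lambert.e₂ ω)) :=
    hfm.lintegral_prod_right'
  have hθm : ∀ s : ℝ, Measurable fun θ : ℝ => ENNReal.ofReal ((2 * π)⁻¹) *
      F (s • ω + √(1 - s ^ 2) • (Real.cos θ • Lambert.e₁ ω + Real.sin θ • Lambert.e₂ ω)) :=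
    fun s => hfm.comp (measurable_const.prodMk measurable_id)
  -- left side
  have hmeasL : Measurable fun ξ : V3 => F (lambertDir ω ξ) :=
    hF.comp (measurable_const.lambertDir measurable_id)
  have keyL := hRA (fun t => ∫⁻ θ in Ioo (-π) π, ENNReal.ofReal ((2 * π)⁻¹) *
      F (√((1 + t) / 2) • ω + √(1 - (√((1 + t) / 2)) ^ 2) •
        (Real.cos θ • Lambert.e₁ ω + Real.sin θ • Lambert.e₂ ω))) (hGtm.comp (by fun_prop))
  have hL : ∫⁻ ξ, F (lambertDir ω ξ) ∂(stdGaussian V3) =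
      2⁻¹ * ∫⁻ t in Icc (-1 : ℝ) 1, ∫⁻ θ in Ioo (-π) π, ENNReal.ofReal ((2 * π)⁻¹) *
        F (√((1 + t) / 2) • ω + √(1 - (√((1 + t) / 2)) ^ 2) •
          (Real.cos θ • Lambert.e₁ ω + Real.sin θ • Lambert.e₂ ω)) := by
    rw [← keyL, lintegral_stdGaussian_framePolar hω hmeasL]
    refine lintegral_congr fun c => ?_
    refine setLIntegral_congr_fun measurableSet_Ioi fun r hr => ?_
    simp_rw [integrand_left hω F c hr]
    rw [lintegral_const_mul _ (hθm _)]
  -- right side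
  have hmeasR : Measurable fun ξ : V3 =>
      ENNReal.ofReal (4 * max (⟪ω, ‖ξ‖⁻¹ • ξ⟫_ℝ) 0) * F (‖ξ‖⁻¹ • ξ) := by
    have hn : Measurable fun ξ : V3 => ‖ξ‖⁻¹ • ξ := measurable_norm.inv.smul measurable_id
    exact (ENNReal.measurable_ofReal.comp (measurable_const.mul
      ((measurable_const.inner hn).max measurable_const))).mul (hF.comp hn)
  have hwm : Measurable fun t : ℝ => ENNReal.ofReal (4 * max t 0) :=
    ENNReal.measurable_ofReal.comp (measurable_const.mul (measurable_id.max measurable_const))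
  have keyR := hRA (fun t => ENNReal.ofReal (4 * max t 0) * ∫⁻ θ in Ioo (-π) π,
      ENNReal.ofReal ((2 * π)⁻¹) * F (t • ω + √(1 - t ^ 2) •
        (Real.cos θ • Lambert.e₁ ω + Real.sin θ • Lambert.e₂ ω))) (hwm.mul hGtm)
  have hR : ∫⁻ ξ, ENNReal.ofReal (4 * max (⟪ω, ‖ξ‖⁻¹ • ξ⟫_ℝ) 0) * F (‖ξ‖⁻¹ • ξ)
        ∂(stdGaussian V3) =
      2⁻¹ * ∫⁻ t in Icc (-1 : ℝ) 1, ENNReal.ofReal (4 * max t 0) * ∫⁻ θ in Ioo (-π) π,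
        ENNReal.ofReal ((2 * π)⁻¹) * F (t • ω + √(1 - t ^ 2) •
          (Real.cos θ • Lambert.e₁ ω + Real.sin θ • Lambert.e₂ ω)) := by
    rw [← keyR, lintegral_stdGaussian_framePolar hω hmeasR]
    refine lintegral_congr fun c => ?_
    refine setLIntegral_congr_fun measurableSet_Ioi fun r hr => ?_
    simp_rw [integrand_right hω F c hr]
    rw [lintegral_const_mul _ ((hθm _).const_mul _), lintegral_const_mul _ (hθm _)]
  rw [hL, hR]
  exact setLIntegral_comp_halfAngle (fun s => ∫⁻ θ in Ioo (-π) π, ENNReal.ofReal ((2 * π)⁻¹) *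
    F (s • ω + √(1 - s ^ 2) • (Real.cos θ • Lambert.e₁ ω + Real.sin θ • Lambert.e₂ ω))) ▸ rfl

/-- **The Lambert (Knudsen cosine) law of the redrawn direction** (stub `stub_lambertLaw` of line
`Sketch`, given radial Archimedes `hRA`): for `ω ≠ 0` and measurable `F ≥ 0`,
`∫ F(lambertDir ω ξ) dγ(ξ) = ∫ 4 (⟪ω̂, ξ̂⟫)₊ F(ξ̂) dγ(ξ)` — the law of `normalize(ω̂ + ξ̂)` is the
uniform law of `ξ̂` weighted by `4(n·ω̂)₊`, the cosine law on the outgoing hemisphere.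
[cite: CometsEtAl2008, §2.1] -/
theorem lambertLaw_of_radialArchimedes
    (hRA : ∀ G : ℝ → ℝ≥0∞, Measurable G →
      ∫⁻ x, (∫⁻ r in Set.Ioi (0 : ℝ), ENNReal.ofReal (r * Real.exp (-r ^ 2 / 2)) *
          G (x / Real.sqrt (x ^ 2 + r ^ 2))) ∂(gaussianReal 0 1) =
        2⁻¹ * ∫⁻ t in Set.Icc (-1 : ℝ) 1, G t) :
    ∀ ω : V3, ω ≠ 0 → ∀ F : V3 → ℝ≥0∞, Measurable F →
      ∫⁻ ξ, F (lambertDir ω ξ) ∂(stdGaussian V3) =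
        ∫⁻ ξ, ENNReal.ofReal (4 * max (⟪‖ω‖⁻¹ • ω, ‖ξ‖⁻¹ • ξ⟫_ℝ) 0) * F (‖ξ‖⁻¹ • ξ)
          ∂(stdGaussian V3) := by
  intro ω hω F hF
  have hn : ‖ω‖ ≠ 0 := norm_ne_zero_iff.2 hω
  have hunit : ‖‖ω‖⁻¹ • ω‖ = 1 := by rw [norm_smul, norm_inv, norm_norm, inv_mul_cancel₀ hn]
  have hdir : ∀ ξ, lambertDir ω ξ = lambertDir (‖ω‖⁻¹ • ω) ξ := fun ξ =>
    (lambertDir_smul_left (inv_pos.2 (norm_pos_iff.2 hω)) ω ξ).symm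
  simp_rw [hdir]
  exact lambertLaw_unit hRA hunit hF

/-! ### The unconditional statements -/

/-- **The Lambert (Knudsen cosine) law of the redrawn direction** — the registered stub
`stub_lambertLaw` of line `Sketch` of crux `LambertianEuler` (stmt-AtomisticToContinuum-11854),
proved unconditionally: for `ω ≠ 0` and measurable `F ≥ 0`,
`∫ F(lambertDir ω ξ) dγ(ξ) = ∫ 4 (⟪ω̂, ξ̂⟫)₊ F(ξ̂) dγ(ξ)`. The law of `normalize(ω̂ + ξ̂)` for `ξ`
standard Gaussian in `ℝ³` is the uniform law of `ξ̂` weighted by `4(n·ω̂)₊`, i.e. the cosine law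
`(n·ω̂)₊ dσ(n)/π` on the outgoing hemisphere — equivalently, the cosine redraw maps the incoming
contact flux onto the outgoing contact flux (the boundary identity of Liouville's theorem for the
Lambertian hard-sphere gas). [cite: CometsEtAl2008, §2.1] -/
theorem lambertLaw : ∀ ω : V3, ω ≠ 0 → ∀ F : V3 → ℝ≥0∞, Measurable F →
    ∫⁻ ξ, F (lambertDir ω ξ) ∂(stdGaussian V3) =
      ∫⁻ ξ, ENNReal.ofReal (4 * max (⟪‖ω‖⁻¹ • ω, ‖ξ‖⁻¹ • ξ⟫_ℝ) 0) * F (‖ξ‖⁻¹ • ξ)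
        ∂(stdGaussian V3) :=
  lambertLaw_of_radialArchimedes radialArchimedes

/-- **Registered stub `stub_lambertLaw`** of line `Sketch` (crux stmt-AtomisticToContinuum-11854),
by name with its registered signature. [cite: CometsEtAl2008, §2.1] -/
theorem stub_lambertLaw :
    ∀ ω : V3, ω ≠ 0 → ∀ F : V3 → ℝ≥0∞, Measurable F →
    ∫⁻ ξ, F (lambertDir ω ξ) ∂(stdGaussian V3) =
      ∫⁻ ξ, ENNReal.ofReal (4 * max (⟪‖ω‖⁻¹ • ω, ‖ξ‖⁻¹ • ξ⟫_ℝ) 0) * F (‖ξ‖⁻¹ • ξ)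
        ∂(stdGaussian V3) :=
  lambertLaw

end Summit.AtomisticToContinuum.HydrodynamicLimit.Theorems.LambertianContactSwapLambertianEulerLambertLaw

end
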